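import Mathlib
import HarnessLib.Audit
import Summits.PneNP.PneNP.Theorems.PstarGateOrFamilyCross
import Summits.PneNP.PneNP.Theorems.PstarGateCaseTN3Tools
import Summits.PneNP.PneNP.Theorems.PstarGateBudget
import Summits.PneNP.PneNP.Theorems.PstarGateCaseTPair
import Summits.PneNP.PneNP.Theorems.PstarGateUnitCycleRankSix

/-!
# One GATED chord: the OR-reader family leaves at most five core outputs — E2 node N3X closed (prover-1 g19)

FRONTIER range-avoidance ladder, rung F-N3 (`stmt-PneNP-19007`), cell `pnp-ideate` (`PstarGateNodesX.GateOrFamilyX`); restricted-model proof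
complexity — nothing here bears on `P` versus `NP`.

CASE T with affine `q_mv` and another chord.  Let `F = J₀ ∖ N`, `Pd` = the `u`-avoiding edges of `D e` private within `D e`, `Pv ⊆ Pd` the tree
edges private within `J₀ ∪ {g₀}` (`PstarGateCaseTN3Tools.private_mem_cycle`).  Then `#F + 1 ≤ #N + 2·#Pv` (`gate_budget`),
`#D e ≤ 2·#Pd + 2·[no u-edge on D e]` (`cycle_budget`), `#N ≤ 3` (`caseT_card_others_le_two`); three edges in `Pd` give rank six
(`caseT_six_false_affine`), two give the cube contradiction (`caseT_affine_cube_false`; a cross pair is a tree edge — violating privacy — or a cross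
gate, killed by `gate_budget_cross`).  With `#Pd ≤ 1` the two budgets force `D e = {π, m}` with `m ∋ u` meeting `xpair e`, every other chord's
`u`-edge off `D e`; two other chords would put two `u`-edges on one endpoint of `e` (`matching_of_through`), and one other chord gives `#J₀ = 5`:

* `gateOrFamilyX_holds` — **`GateOrFamilyX`.**
-/

set_option linter.dupNamespace false -- `Summit.PneNP.PneNP.…`: summit = sub-problem name (D-0017 single-conjunct layout)

open Finset Module Literature.Computability.Complexity
open scoped symmDiff
open Summit.PneNP.PneNP.Theorems.PstarTyped (Typed)
open Summit.PneNP.PneNP.Theorems.PstarSALevel (varSet bdry BoundaryExpanding SimpleOverlap)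
open Summit.PneNP.PneNP.Theorems.PstarGapLinearised (andPair andPair_subset_varSet)
open Summit.PneNP.PneNP.Theorems.PstarChordEndgameTools (mem_andPair_iff not_two_shared)
open Summit.PneNP.PneNP.Theorems.PstarCentreFree (vars_mem_varSet)
open Summit.PneNP.PneNP.Theorems.PstarXCore (xpair xverts mem_xpair)
open Summit.PneNP.PneNP.Theorems.PstarCubeIdeals (IsAffineFn)
open Summit.PneNP.PneNP.Theorems.PstarProductRank (qform polar)
open Summit.PneNP.PneNP.Theorems.PstarQuadRank (rad)
open Summit.PneNP.PneNP.Theorems.PstarPathRank (AndAdj polar_basis)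
open Summit.PneNP.PneNP.Theorems.PstarPathRankFibre (avoid coordKer rank_restrict_ge)
open Summit.PneNP.PneNP.Theorems.PstarReadSumset (V2)
open Summit.PneNP.PneNP.Theorems.PstarChordSystem (ChordSystem)
open Summit.PneNP.PneNP.Theorems.PstarChordBridgeTools (privs coef xpdeg)
open Summit.PneNP.PneNP.Theorems.PstarChordBridge (BridgeData sys)
open Summit.PneNP.PneNP.Theorems.PstarChordBridgeForcing (gam freeMon freePolar)
open Summit.PneNP.PneNP.Theorems.PstarChordBridgeBasis (qDir polarDir)
open Summit.PneNP.PneNP.Theorems.PstarChordBridgeFundamental (two_le_card_of_even eq_of_fundamental_eq)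
open Summit.PneNP.PneNP.Theorems.PstarGateBridge (GateHyp)
open Summit.PneNP.PneNP.Theorems.PstarGateNodes (GateData)
open Summit.PneNP.PneNP.Theorems.PstarGateNodesX
open Summit.PneNP.PneNP.Theorems.PstarGateCaseTCycle (matching_of_through)
open Summit.PneNP.PneNP.Theorems.PstarGateUnitCycleRankSix (rank_six_of_private)
open Summit.PneNP.PneNP.Theorems.PstarGateBudget (gate_budget)
open Summit.PneNP.PneNP.Theorems.PstarGateCaseTPair (xpair_subset_xverts_D)
open Summit.PneNP.PneNP.Theorems.PstarGateCaseTStructure (caseT_diff_single caseT_card_others_le_two)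
open Summit.PneNP.PneNP.Theorems.PstarGateCaseTSixAffine (caseT_six_false_affine)
open Summit.PneNP.PneNP.Theorems.PstarGateOrFamilyCross (two_private_false)
open Summit.PneNP.PneNP.Theorems.PstarGateCaseTN3Tools (cycle_budget private_mem_cycle)

namespace Summit.PneNP.PneNP.Theorems.PstarGateOrFamilyFinal

variable {n m : ℕ}

/-- An AND variable outside the AND pair of a typed output is outside its variable set. -/
theorem not_mem_varSet_of_not_mem_andPair (I : LocalMap 4 n m) (hT : Typed I) {j j' : Fin m} {s : Fin 4} (hs : 2 ≤ s.val)
    (h : I.vars j s ∉ andPair I j') : I.vars j s ∉ varSet I j' := by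
  classical
  intro hv
  unfold PstarSALevel.varSet at hv
  obtain ⟨t, -, ht⟩ := mem_image.1 hv
  by_cases ht2 : t.val < 2
  · exact hT j' j t s ht2 hs ht
  · have ht23 : t = 2 ∨ t = 3 := by rcases t with ⟨t, h4⟩; simp only [Fin.ext_iff]; simp only at ht2; omega
    rcases ht23 with rfl | rfl
    · exact h ((mem_andPair_iff I j' _).2 (Or.inl ht.symm))
    · exact h ((mem_andPair_iff I j' _).2 (Or.inr ht.symm))

/-- **N3X.** -/
theorem gateOrFamilyX_holds : GateOrFamilyX := by
  classical
  intro n m r₀ I hI hT hS hB B e g₀ u κ₀ hD mv hmvT hRA hAR hN hq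
  have hP : ∀ e' ∈ B.N, e' ≠ e → ∀ a, ((sys I B).ρ e' a = 0 ∨ (sys I B).ρ e' a = mv) ∧ ((sys I B).ρ' e' a = 0 ∨ (sys I B).ρ' e' a = mv) :=
    hRA
  have hread : ∀ e' ∈ B.N, e' ≠ e → ∀ a, (sys I B).ρ e' a ≠ 0 ∨ (sys I B).ρ' e' a ≠ 0 := hAR
  by_contra h5
  push Not at h5
  obtain ⟨hXc, hW, hr, hd₁, hd₂, -, -, -, hG, hg₀, hgv, -⟩ := id hD
  have he : e ∈ B.N := hG.1
  have heJ : e ∈ B.J₀ := hW.hN he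
  have hg₀J : g₀ ∉ B.J₀ := fun h => disjoint_left.1 hd₁ hg₀ h
  have heD : e ∉ B.D e := fun h => (mem_sdiff.1 (hW.hD e he h)).2 he
  have hDeF : B.D e ⊆ B.J₀ \ B.N := hW.hD e he
  have hDeJ : B.D e ⊆ B.J₀ := hDeF.trans sdiff_subset
  set F := B.J₀ \ B.N with hFdef
  have hJcard : B.J₀.card = F.card + B.N.card := by
    have h1 := card_sdiff_add_card_eq_card hW.hN
    rw [← hFdef] at h1
    omega
  have hN3 : B.N.card ≤ 3 := by
    have h := caseT_card_others_le_two I hI hT hS hB hD hmvT hP hread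
    rw [card_erase_of_mem he] at h
    omega
  have hN2 : 2 ≤ B.N.card := by
    obtain ⟨e₁, he₁⟩ := hN
    have h := card_pos.2 ⟨e₁, he₁⟩
    rw [card_erase_of_mem he] at h
    omega
  -- the De-private avoiding edges
  set Pd := (B.D e).filter (fun j => I.vars j 2 ≠ u ∧ I.vars j 3 ≠ u ∧
    ∀ j' ∈ B.D e, j' ≠ j → I.vars j 2 ∉ andPair I j' ∧ I.vars j 3 ∉ andPair I j') with hPd
  have hPdD : Pd ⊆ B.D e := filter_subset _ _
  have memPd : ∀ {j}, j ∈ Pd ↔ j ∈ B.D e ∧ I.vars j 2 ≠ u ∧ I.vars j 3 ≠ u ∧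
      ∀ j' ∈ B.D e, j' ≠ j → I.vars j 2 ∉ andPair I j' ∧ I.vars j 3 ∉ andPair I j' := fun {j} => by rw [hPd, mem_filter]
  -- (1) the global budget, with `Pv ⊆ Pd`
  obtain ⟨Pv, hPvF, hPvpriv, hbudget⟩ := gate_budget I hB hD
  change F.card + 1 ≤ _ at hbudget
  have hPvPd : Pv ⊆ Pd := fun j hj =>
    memPd.2 (private_mem_cycle I hI hT hS hB hD hmvT hP hread hq (hPvF hj) (hPvpriv j hj))
  have hPvle := card_le_card hPvPd
  -- (2) rank six: `#Pd ≤ 2`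
  have hmemav : ∀ {j}, j ∈ B.D e → I.vars j 2 ≠ u → I.vars j 3 ≠ u → j ∈ avoid I (B.D e) {u} := by
    intro j hj hj2 hj3
    unfold PstarPathRankFibre.avoid
    exact mem_filter.2 ⟨hj, by rwa [mem_singleton], by rwa [mem_singleton]⟩
  have havD : avoid I (B.D e) {u} ⊆ B.D e := filter_subset _ _
  have hprivV : ∀ {π}, π ∈ Pd → ∀ j' ∈ avoid I (B.D e) {u}, j' ≠ π → I.vars π 2 ∉ varSet I j' ∧ I.vars π 3 ∉ varSet I j' := by
    intro π hπ j' hj' hne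
    have h := (memPd.1 hπ).2.2.2 j' (havD hj') hne
    exact ⟨not_mem_varSet_of_not_mem_andPair I hT (by decide) h.1, not_mem_varSet_of_not_mem_andPair I hT (by decide) h.2⟩
  have hPd2 : Pd.card ≤ 2 := by
    by_contra h3
    obtain ⟨π₁, hπ₁, π₂, hπ₂, π₃, hπ₃, h12, h13, h23⟩ := two_lt_card.1 (show 2 < Pd.card by omega)
    obtain ⟨h1D, h1u2, h1u3, -⟩ := memPd.1 hπ₁
    obtain ⟨h2D, h2u2, h2u3, -⟩ := memPd.1 hπ₂
    obtain ⟨h3D, h3u2, h3u3, -⟩ := memPd.1 hπ₃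
    have h := rank_six_of_private I hI hS (hmemav h1D h1u2 h1u3) (hmemav h2D h2u2 h2u3) (hmemav h3D h3u2 h3u3) h12 h13 h23
      (hprivV hπ₁) (hprivV hπ₂)
    have hrg := rank_restrict_ge I (B.D e) ({u} : Finset (Fin n))
    exact caseT_six_false_affine I hI hT hS hB hD hmvT hP hread hN hq (by omega)
  -- (3) the cube / cross pairs: `#Pd ≠ 2`
  have hPd1 : Pd.card ≤ 1 := by
    by_contra h2
    have hPdc : Pd.card = 2 := by omega
    obtain ⟨π, ν, hπν, hPdeq⟩ := card_eq_two.1 hPdc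
    have hπ : π ∈ Pd := by rw [hPdeq]; exact mem_insert_self _ _
    have hν : ν ∈ Pd := by rw [hPdeq]; exact mem_insert_of_mem (mem_singleton_self _)
    obtain ⟨hπD, hπ2, hπ3, hpπ⟩ := memPd.1 hπ
    obtain ⟨hνD, hν2, hν3, hpν⟩ := memPd.1 hν
    refine two_private_false I hI hT hS hB hD hmvT hP hread hN hq hπD hνD hπν hπ2 hπ3 hν2 hν3 hpπ hpν fun j hjD hj2 hj3 hjp => ?_
    have hj : j ∈ Pd := memPd.2 ⟨hjD, hj2, hj3, hjp⟩
    rw [hPdeq, mem_insert, mem_singleton] at hj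
    exact hj
  -- (4) `#Pd ≤ 1`: the two budgets
  have h2De : 2 ≤ (B.D e).card := two_le_card_of_even I hI hS heD (hW.hDeven e he)
  have hcyc := cycle_budget I hI hB hD
  rw [← hPd] at hcyc
  -- every other chord has its `u`-edge, in `F`; if it were on `D e`, that chord's fundamental set would be `D e ∖ {it}`
  have chord_edge : ∀ c ∈ B.N.erase e, ∃ k ∈ F, B.D e ∆ B.D c = {k} ∧ (I.vars k 2 = u ∨ I.vars k 3 = u) ∧
      (I.vars k 0 ∈ xpair I e ∨ I.vars k 1 ∈ xpair I e) ∧ (k ∈ B.D e → (B.D e).card ≥ 3) := by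
    intro c hc
    obtain ⟨k, hk, hku, hkx⟩ := caseT_diff_single I hI hT hS hB hD hmvT hP hread (mem_of_mem_erase hc) (ne_of_mem_erase hc)
    have hkM : k ∈ B.D e ∆ B.D c := by rw [hk]; exact mem_singleton_self _
    have hkF : k ∈ F := by
      rcases Finset.mem_symmDiff.1 hkM with ⟨h, -⟩ | ⟨h, -⟩
      · exact hDeF h
      · exact hW.hD c (mem_of_mem_erase hc) h
    refine ⟨k, hkF, hk, hku, hkx, fun hkD => ?_⟩
    have hcN := mem_of_mem_erase hc
    have hDc : B.D c = (B.D e).erase k := by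
      have h1 : B.D c = B.D e ∆ {k} := by rw [← hk, ← symmDiff_assoc, symmDiff_self, bot_symmDiff]
      rw [h1]; ext j
      simp only [Finset.mem_symmDiff, mem_singleton, mem_erase]
      constructor
      · rintro (⟨h, hne⟩ | ⟨rfl, h⟩)
        · exact ⟨hne, h⟩
        · exact absurd hkD h
      · rintro ⟨hne, h⟩; exact Or.inl ⟨h, hne⟩
    have hcD : c ∉ B.D c := fun h => (mem_sdiff.1 (hW.hD c hcN h)).2 hcN
    have h2c : 2 ≤ (B.D c).card := two_le_card_of_even I hI hS hcD (hW.hDeven c hcN)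
    rw [hDc, card_erase_of_mem hkD] at h2c
    omega
  -- a non-`Pd` avoiding edge of `D e` shares an AND variable with an edge of `D e` other than the private ones
  have shared_partner : ∀ j ∈ B.D e, j ∉ Pd → I.vars j 2 ≠ u → I.vars j 3 ≠ u → ∃ j' ∈ B.D e, j' ≠ j ∧ j' ∉ Pd := by
    intro j hj hjP hj2 hj3
    have hns : ¬ ∀ j' ∈ B.D e, j' ≠ j → I.vars j 2 ∉ andPair I j' ∧ I.vars j 3 ∉ andPair I j' :=
      fun h => hjP (memPd.2 ⟨hj, hj2, hj3, h⟩)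
    push Not at hns
    obtain ⟨j', hj', hne, hv⟩ := hns
    refine ⟨j', hj', hne, fun hj'P => ?_⟩
    have hp' := (memPd.1 hj'P).2.2.2 j hj (Ne.symm hne)
    -- `vars j s ∈ andPair j'` means `vars j s = vars j' t`, i.e. `vars j' t ∈ andPair j`
    have key : ∀ s : Fin 4, (s = 2 ∨ s = 3) → I.vars j s ∈ andPair I j' → False := by
      intro s hs hmem
      have hjs : I.vars j s ∈ andPair I j := by
        rcases hs with rfl | rfl
        exacts [(mem_andPair_iff I j _).2 (Or.inl rfl), (mem_andPair_iff I j _).2 (Or.inr rfl)]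
      rcases (mem_andPair_iff I j' _).1 hmem with h | h
      · exact hp'.1 (h ▸ hjs)
      · exact hp'.2 (h ▸ hjs)
    by_cases h2 : I.vars j 2 ∈ andPair I j'
    · exact key 2 (Or.inl rfl) h2
    · exact key 3 (Or.inr rfl) (hv h2)
  -- Case split on a `u`-edge on `D e`
  by_cases hU : ∃ j ∈ B.D e, I.vars j 2 = u ∨ I.vars j 3 = u
  · rw [if_pos hU] at hcyc
    -- `#D e = 2`, `Pd = {π}`, `D e = {π, m}` with `m ∋ u`
    have hDe2 : (B.D e).card = 2 := by omega
    have hPd1' : Pd.card = 1 := by omega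
    obtain ⟨π, hPdeq⟩ := card_eq_one.1 hPd1'
    have hπ : π ∈ Pd := by rw [hPdeq]; exact mem_singleton_self _
    obtain ⟨hπD, hπ2, hπ3, -⟩ := memPd.1 hπ
    obtain ⟨mᵤ, hmᵤD, hmᵤu⟩ := hU
    have hmπ : mᵤ ≠ π := by rintro rfl; rcases hmᵤu with h | h; exacts [hπ2 h, hπ3 h]
    have hDeq : B.D e = {π, mᵤ} := by
      refine (eq_of_subset_of_card_le (insert_subset hπD (singleton_subset_iff.2 hmᵤD)) ?_).symm
      rw [hDe2, card_pair (Ne.symm hmπ)]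
    -- no other chord's `u`-edge lies on `D e` (it would need `#D e ≥ 3`), so `mᵤ` is not one of them; and `mᵤ` meets `xpair e`
    have hmx : I.vars e 0 ∈ xpair I mᵤ ∨ I.vars e 1 ∈ xpair I mᵤ := by
      have hsub := xpair_subset_xverts_D I hI hW he
      have hvx : ∀ w ∈ xpair I e, w ∈ xpair I π ∨ w ∈ xpair I mᵤ := by
        intro w hw
        have h := hsub hw
        unfold PstarXCore.xverts at h
        obtain ⟨j, hj, hjw⟩ := mem_biUnion.1 h
        rw [hDeq, mem_insert, mem_singleton] at hj
        rcases hj with rfl | rfl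
        exacts [Or.inl hjw, Or.inr hjw]
      by_contra hno
      rw [not_or] at hno
      have ha := (hvx _ ((mem_xpair I).2 (Or.inl rfl))).resolve_right hno.1
      have hb := (hvx _ ((mem_xpair I).2 (Or.inr rfl))).resolve_right hno.2
      have hxs : ∀ {i : Fin m} {v : Fin n}, v ∈ xpair I i → v ∈ varSet I i := by
        intro i v hv; rcases (mem_xpair I).1 hv with rfl | rfl; exacts [vars_mem_varSet I i 0, vars_mem_varSet I i 1]
      have h01 : I.vars e 0 ≠ I.vars e 1 := fun h => absurd (hI.2 e h) (by decide)
      have hπe : π ≠ e := fun h => heD (h ▸ hπD)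
      exact not_two_shared I hS hπe h01 (hxs ha) (vars_mem_varSet I e 0) (hxs hb) (vars_mem_varSet I e 1)
    -- the other chords
    obtain ⟨e₁, he₁⟩ := id hN
    obtain ⟨m₁, hm₁F, hM₁, hm₁u, hm₁x, hm₁D⟩ := chord_edge e₁ he₁
    have hm₁nD : m₁ ∉ B.D e := fun h => by have := hm₁D h; omega
    have hm₁m : m₁ ≠ mᵤ := fun h => hm₁nD (h ▸ hmᵤD)
    have hm₁π : m₁ ≠ π := fun h => hm₁nD (h ▸ hπD)
    by_cases hN2' : B.N.card = 2
    · -- one other chord: `F ⊇ {π, mᵤ, m₁}` and `#F + 1 ≤ 2 + 2·#Pv ≤ 4`, so `#J₀ ≤ 5`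
      have h3 : F.card ≤ 3 := by omega
      omega
    · -- two other chords: their `u`-edges sit at distinct endpoints of `e`, and `mᵤ` clashes with one of them
      have hk2 : (B.N.erase e).card = 2 := by rw [card_erase_of_mem he]; omega
      obtain ⟨c₁, c₂, hc12, hNe⟩ := card_eq_two.1 hk2
      have hc₁ : c₁ ∈ B.N.erase e := by rw [hNe]; exact mem_insert_self _ _
      have hc₂ : c₂ ∈ B.N.erase e := by rw [hNe]; exact mem_insert_of_mem (mem_singleton_self _)
      obtain ⟨n₁, -, hMn₁, hn₁u, hn₁x, hn₁D⟩ := chord_edge c₁ hc₁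
      obtain ⟨n₂, -, hMn₂, hn₂u, hn₂x, hn₂D⟩ := chord_edge c₂ hc₂
      have hn₁m : n₁ ≠ mᵤ := fun h => by have := hn₁D (h ▸ hmᵤD); omega
      have hn₂m : n₂ ≠ mᵤ := fun h => by have := hn₂D (h ▸ hmᵤD); omega
      have hn12 : n₁ ≠ n₂ := by
        intro h12
        subst h12
        have hDD : B.D c₁ = B.D c₂ := by
          have h1 : B.D c₁ = B.D e ∆ {n₁} := by rw [← hMn₁, ← symmDiff_assoc, symmDiff_self, bot_symmDiff]
          have h2 : B.D c₂ = B.D e ∆ {n₁} := by rw [← hMn₂, ← symmDiff_assoc, symmDiff_self, bot_symmDiff]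
          rw [h1, h2]
        have hc₁N := mem_of_mem_erase hc₁
        have hc₂N := mem_of_mem_erase hc₂
        have hcD : c₁ ∉ B.D c₁ := fun h => (mem_sdiff.1 (hW.hD c₁ hc₁N h)).2 hc₁N
        have hc'D : c₂ ∉ B.D c₁ := fun h => (mem_sdiff.1 (hW.hD c₁ hc₁N h)).2 hc₂N
        have hev' : ∀ w, Even (xpdeg I (insert c₂ (B.D c₁)) w) := fun w => by rw [hDD]; exact hW.hDeven c₂ hc₂N w
        exact hc12 (eq_of_fundamental_eq I hI hS hcD hc'D (hW.hDeven c₁ hc₁N) hev')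
      -- endpoints
      have hmem : ∀ {k : Fin m} {s : Fin 4}, (s = 0 ∨ s = 1) → I.vars k s ∈ xpair I k := by
        intro k s hs; rcases hs with rfl | rfl; exacts [(mem_xpair I).2 (Or.inl rfl), (mem_xpair I).2 (Or.inr rfl)]
      have hend : ∀ {k : Fin m}, (I.vars k 0 ∈ xpair I e ∨ I.vars k 1 ∈ xpair I e) → I.vars e 0 ∈ xpair I k ∨ I.vars e 1 ∈ xpair I k := by
        intro k hk
        rcases hk with h | h
        · rcases (mem_xpair I).1 h with h' | h'
          exacts [Or.inl (h' ▸ hmem (Or.inl rfl)), Or.inr (h' ▸ hmem (Or.inl rfl))]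
        · rcases (mem_xpair I).1 h with h' | h'
          exacts [Or.inl (h' ▸ hmem (Or.inr rfl)), Or.inr (h' ▸ hmem (Or.inr rfl))]
      have clash : ∀ {k k' : Fin m}, k ≠ k' → (I.vars k 2 = u ∨ I.vars k 3 = u) → (I.vars k' 2 = u ∨ I.vars k' 3 = u) →
          ∀ w, w ∈ xpair I k → w ∈ xpair I k' → False :=
        fun hkk hk hk' w hw hw' => matching_of_through I hI hS hkk hk hk' hw hw'
      rcases hend hn₁x with ha₁ | hb₁ <;> rcases hend hn₂x with ha₂ | hb₂ <;> rcases hmx with ham | hbm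
      · exact clash hn12 hn₁u hn₂u _ ha₁ ha₂
      · exact clash hn12 hn₁u hn₂u _ ha₁ ha₂
      · exact clash hn₁m hn₁u hmᵤu _ ha₁ ham
      · exact clash hn₂m hn₂u hmᵤu _ hb₂ hbm
      · exact clash hn₂m hn₂u hmᵤu _ ha₂ ham
      · exact clash hn₁m hn₁u hmᵤu _ hb₁ hbm
      · exact clash hn12 hn₁u hn₂u _ hb₁ hb₂
      · exact clash hn12 hn₁u hn₂u _ hb₁ hb₂
  · rw [if_neg hU] at hcyc
    push Not at hU
    -- no `u`-edge on `D e`: every other chord's edge is off `D e`, and the budget gives `#D e ≤ 2·#Pv ≤ 2`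
    obtain ⟨e₁, he₁⟩ := id hN
    -- `F ⊇ D e ∪ {u-edges of other chords}` with `#(N ∖ e)` distinct such edges
    have hcount : (B.D e).card + (B.N.erase e).card ≤ F.card := by
      -- the map `c ↦ m_c` is injective into `F ∖ D e`
      have himg : ∀ c ∈ B.N.erase e, ∃ k ∈ F \ B.D e, B.D e ∆ B.D c = {k} := by
        intro c hc
        obtain ⟨k, hkF, hk, hku, -, -⟩ := chord_edge c hc
        refine ⟨k, mem_sdiff.2 ⟨hkF, fun hkD => ?_⟩, hk⟩
        rcases hku with h | h
        · exact (hU k hkD).1 h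
        · exact (hU k hkD).2 h
      choose! f hf using himg
      have hinj : Set.InjOn f (B.N.erase e) := by
        intro c₁ hc₁ c₂ hc₂ h12
        by_contra hc12
        have hM₁ := (hf c₁ hc₁).2
        have hM₂ := (hf c₂ hc₂).2
        rw [h12] at hM₁
        have hDD : B.D c₁ = B.D c₂ := by
          have h1 : B.D c₁ = B.D e ∆ {f c₂} := by rw [← hM₁, ← symmDiff_assoc, symmDiff_self, bot_symmDiff]
          have h2 : B.D c₂ = B.D e ∆ {f c₂} := by rw [← hM₂, ← symmDiff_assoc, symmDiff_self, bot_symmDiff]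
          rw [h1, h2]
        have hc₁N := mem_of_mem_erase hc₁
        have hc₂N := mem_of_mem_erase hc₂
        have hcD : c₁ ∉ B.D c₁ := fun h => (mem_sdiff.1 (hW.hD c₁ hc₁N h)).2 hc₁N
        have hc'D : c₂ ∉ B.D c₁ := fun h => (mem_sdiff.1 (hW.hD c₁ hc₁N h)).2 hc₂N
        have hev' : ∀ w, Even (xpdeg I (insert c₂ (B.D c₁)) w) := fun w => by rw [hDD]; exact hW.hDeven c₂ hc₂N w
        exact hc12 (eq_of_fundamental_eq I hI hS hcD hc'D (hW.hDeven c₁ hc₁N) hev')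
      have hcard_img : ((B.N.erase e).image f).card = (B.N.erase e).card := card_image_of_injOn hinj
      have hsub : (B.N.erase e).image f ⊆ F \ B.D e := by
        intro k hk
        obtain ⟨c, hc, rfl⟩ := mem_image.1 hk
        exact (hf c hc).1
      have h1 := card_le_card hsub
      rw [hcard_img, card_sdiff_of_subset hDeF] at h1
      have h2 := card_le_card hDeF
      omega
    have hk : (B.N.erase e).card + 1 = B.N.card := by rw [card_erase_of_mem he]; omega
    -- so `#D e ≤ 2·#Pv ≤ 2·#Pd ≤ 2`: `D e = {π, j}` with `j ∉ Pd` avoiding `u` — sharing with `π`, impossible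
    have hDe2 : (B.D e).card = 2 := by omega
    have hPd1' : Pd.card = 1 := by omega
    obtain ⟨π, hPdeq⟩ := card_eq_one.1 hPd1'
    have hπ : π ∈ Pd := by rw [hPdeq]; exact mem_singleton_self _
    obtain ⟨hπD, -, -, -⟩ := memPd.1 hπ
    obtain ⟨j, hjD, hjπ⟩ : ∃ j ∈ B.D e, j ≠ π := by
      have h := card_erase_of_mem hπD
      obtain ⟨j, hj⟩ := card_pos.1 (by rw [h]; omega : 0 < ((B.D e).erase π).card)
      exact ⟨j, mem_of_mem_erase hj, ne_of_mem_erase hj⟩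
    have hjP : j ∉ Pd := by rw [hPdeq, mem_singleton]; exact hjπ
    obtain ⟨j', hj'D, hj'j, hj'P⟩ := shared_partner j hjD hjP (hU j hjD).1 (hU j hjD).2
    -- `D e = {π, j}`, so `j' = π ∈ Pd`: contradiction
    have hj'π : j' = π := by
      by_contra hne
      have h3 : ({π, j, j'} : Finset (Fin m)) ⊆ B.D e := insert_subset hπD (insert_subset hjD (singleton_subset_iff.2 hj'D))
      have hc3 : ({π, j, j'} : Finset (Fin m)).card = 3 := by
        rw [card_insert_of_notMem, card_insert_of_notMem, card_singleton]
        · rw [mem_singleton]; exact Ne.symm hj'j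
        · rw [mem_insert, mem_singleton, not_or]; exact ⟨Ne.symm hjπ, Ne.symm hne⟩
      have := card_le_card h3
      omega
    exact hj'P (hj'π ▸ hπ)

end Summit.PneNP.PneNP.Theorems.PstarGateOrFamilyFinal
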